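import Summits.Langlands.Langlands.Theorems.IrreducibilityBySelfDualityIrreducibleOffSectorOpenRegionsV2
import Summits.Langlands.Langlands.Theorems.IrreducibilityBySelfDualityIrreducibleOffSectorRankTwoRegularNoPole
import HarnessLib

/-!
# `IrreducibleOffSector` from its open regions, v3: the rank-two conjunct sharpened
(crux stmt-Langlands-14329 `IrreducibilityBySelfDuality.IrreducibleOffSector`, line `Sketch`;
`--supports` file, STRUCTURAL: no import of the route module; continuation lead c5)

The certified maps v1 (p118444) and v2 (p123825, Galois-type and monomial regions carved out) feed
the WHOLE rank-two case through Buzzard–Gee's Conjecture 3.1.6 for L-algebraic cuspidal `GL_2`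
("L-algebraic ⇒ L-arithmetic", `hLA2`).  For REGULAR `π` that conjecture is not needed: lead c1's
`isIrreducible_rank_two_of_isRegular_of_boundary` (p115614) proves the rank-two regular slice over
EVERY number field from Clozel's Hecke field (the text of the input `HeckeEigenvalueField`) and
Arthur–Clozel (2.2) alone (the L-algebraic regular `π` is a half-integral twist of a regular algebraic
one; Böckle–Hui Thm. 1.1 + Jacquet–Shalika).  This v3 map therefore asks Conjecture 3.1.6 ONLY for
the residual rank-two representations — IRREGULAR (weight-one / Maass-`¼` type at some place),
NOT of Galois type, NOT monomial — which is exactly the open part of BG 3.1.6 for `GL_2`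
(`hLA2res`), and is otherwise v2 verbatim (`irreducibleOffSector_text_of_open_regions_v3`).

So, modulo printed theorems (lang.S27, Böckle–Hui 1.1/1.2, Clozel's Hecke field, Jacquet–Shalika
(2.2)), the crux is equivalent to the conjunction of: BG 3.1.6 for residual irregular cuspidal
`GL_2`; `H4att`; and the three residual regions `H3irr'`, `H3esd'`, `H4rest'`.

References: K. Buzzard, T. Gee, LMS LNS 414 (2014), Conj. 3.1.6; L. Clozel (1990), Thm. 3.13;
G. Böckle, C.-Y. Hui, Math. Ann. 393 (2025), Thms. 1.1–1.2; J. Arthur, L. Clozel (1989), Ch. 3 (2.2).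
-/

noncomputable section

set_option linter.dupNamespace false

open scoped NumberField Classical
open Filter IsDedekindDomain NumberField
open Literature.NumberTheory.Automorphic Literature.NumberTheory.GaloisRepresentations
open Summit.Langlands

namespace Summit.Langlands.Langlands.Theorems.IrreducibleOffSector

/-! ### Rank two: regular slice unconditional in BG 3.1.6, residual slice through it -/

/-- **Rank-two dispatch.**  For a cuspidal L-algebraic `π` on `GL_2(𝔸_K)` (any `K`), `ℓ`, `ι`:
REGULAR `π` — every a.e.-compatible `ρ` is irreducible by `isIrreducible_rank_two_of_isRegular_of_boundary`
(p115614; Clozel's Hecke field + Arthur–Clozel (2.2) + Böckle–Hui 1.1); `π` of Galois type or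
monomial — by the landed regions (`conclusion_of_not_galoisType_not_monomial`); otherwise — from
L-arithmeticity of `π` (`hres`, Buzzard–Gee 3.1.6 for this residual `π`) by
`isIrreducible_rank_two_of_isLArithmetic` (p117977).
[cite: BuzzardGeeLMS2014, Conj. 3.1.6] [cite: BockleHui2025, Theorem 1.1] -/
theorem conclusion_rank_two_of_isRegular_or_residual_isLArithmetic
    (hWA : ∀ (K : Type) [Field K] [NumberField K] (h1 : isCompact_glFiniteIntegralLevel 1 K) (ℓ : ℕ) [Fact ℓ.Prime] (n : ℕ) (E : Type) [Field E] [NumberField E] (e : E →+* PadicAlgCl ℓ) (ρ : FramedGaloisRep K (PadicAlgCl ℓ) n), ρ.toGaloisRep.IsSemisimple → (∀ᶠ v in cofinite, ρ.IsUnramifiedAt v ∧ ∃ P : Polynomial E, ρ.HasFrobCharpolyAt v (P.map e)) → ∀ (ψ : FramedGaloisRep K (PadicAlgCl ℓ) 1), (∀ᶠ v in cofinite, ρ.IsUnramifiedAt v ∧ ψ.IsUnramifiedAt v ∧ ∀ 𝔓 ∈ v.primesAbove, ∀ σ : Field.absoluteGaloisGroup K, IsArithFrobAt (𝓞 K) σ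 𝔓 → ψ.charpoly σ ∣ ρ.charpoly σ) → ∀ (ι : PadicAlgCl ℓ ≃+* ℂ), ∃ χ : CuspidalAutomorphicRepData 1 K h1, χ.1.IsRegularAlgebraic ∧ ∀ᶠ v in cofinite, ∃ c : ℂ, χ.1.HasSatakeParamAt v {c} ∧ ψ.IsUnramifiedAt v ∧ ψ.HasFrobCharpolyAt v (arithFrobPolyOfSatake ι v.residueCard 1 {c}))
    (hHE : Clozel1990_heckeEigenvalueField)
    (h22 : JacquetShalika1981_partialPairL_boundary_repData)
    {K : Type} [Field K] [NumberField K] {hcpt : isCompact_glFiniteIntegralLevel 2 K}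
    (π : CuspidalAutomorphicRepData 2 K hcpt) (hL : π.1.IsLAlgebraic)
    (hres : (¬ ∃ T : InfinityType K 2, π.1.HasInfinityType T ∧ T.IsRegular) →
      (¬ ∃ σ : FramedArtinRep K 2, σ.toGaloisRep.IsIrreducible ∧ IsPiOfArtinRep σ π.1) →
      (¬ ∃ (E : Type) (_ : Field E) (_ : NumberField E) (_ : Algebra K E) (_ : IsGalois K E)
          (h1 : isCompact_glFiniteIntegralLevel 1 E) (τ : AutomorphicRepData (AutomorphyDatum.gl 1 E h1)),
          τ.IsLAlgebraic ∧ IsAutomorphicInductionAlong τ π.1 ∧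
          ∀ g : E ≃ₐ[K] E, g ≠ 1 →
            ¬ ∀ᶠ w : HeightOneSpectrum (𝓞 E) in cofinite, ∀ α : Multiset ℂ,
                τ.HasSatakeParamAt w α → τ.HasSatakeParamAt (g • w) α) →
      ∃ E : Subfield ℂ, FiniteDimensional ℚ E ∧
        ∀ᶠ v : HeightOneSpectrum (𝓞 K) in cofinite, ∀ α : Multiset ℂ, π.1.HasSatakeParamAt v α →
          ∀ i ≤ 2, α.esymm i ∈ E)
    {ℓ : ℕ} [Fact ℓ.Prime] (ι : PadicAlgCl ℓ ≃+* ℂ) (ρ : FramedGaloisRep K (PadicAlgCl ℓ) 2)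
    (hρ : ∀ᶠ v : HeightOneSpectrum (𝓞 K) in cofinite, SatakeFrobCompatibleAt ι π.1 ρ v) :
    ρ.toGaloisRep.IsIrreducible := by
  by_cases hreg : ∃ T : InfinityType K 2, π.1.HasInfinityType T ∧ T.IsRegular
  · exact isIrreducible_rank_two_of_isRegular_of_boundary hWA hHE h22 π hL hreg ι ρ hρ
  · exact conclusion_of_not_galoisType_not_monomial π ι
      (fun hG hM => fun ρ' hρ' => isIrreducible_rank_two_of_isLArithmetic hWA h22 π
        (hres hreg hG hM) ι ρ' hρ') ρ hρ

/-! ### The certified map, v3 -/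

/-- **The crux from its open regions, v3 (rank two: regular slice unconditional in BG 3.1.6).**
As v2 (`irreducibleOffSector_text_of_open_regions_v2`), except that Buzzard–Gee 3.1.6 is asked only
for IRREGULAR L-algebraic cuspidal `π` on `GL_2` that are neither of Galois type nor monomial
(`hLA2res`); regular rank-two `π` go through `isIrreducible_rank_two_of_isRegular_of_boundary`
(Clozel's Hecke field + Arthur–Clozel (2.2), p115614), Galois-type / monomial ones through the landed
regions.  GIVEN the printed inputs, `hLA2res`, `H3irr'`, `H3esd'`, `H4att`, `H4rest'`, the text of
`IrreducibleOffSector` holds verbatim.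
[cite: BuzzardGeeLMS2014, Conj. 3.1.6] [cite: BockleHui2025, Theorem 1.1 and Theorem 1.2] -/
theorem irreducibleOffSector_text_of_open_regions_v3
    (h27 : exists_galoisRep_of_regularAlgebraic)
    (hBH : isIrreducible_galoisRep_gl3_totallyReal)
    (hWA : ∀ (K : Type) [Field K] [NumberField K] (h1 : isCompact_glFiniteIntegralLevel 1 K) (ℓ : ℕ) [Fact ℓ.Prime] (n : ℕ) (E : Type) [Field E] [NumberField E] (e : E →+* PadicAlgCl ℓ) (ρ : FramedGaloisRep K (PadicAlgCl ℓ) n), ρ.toGaloisRep.IsSemisimple → (∀ᶠ v in cofinite, ρ.IsUnramifiedAt v ∧ ∃ P : Polynomial E, ρ.HasFrobCharpolyAt v (P.map e)) → ∀ (ψ : FramedGaloisRep K (PadicAlgCl ℓ) 1), (∀ᶠ v in cofinite, ρ.IsUnramifiedAt v ∧ ψ.IsUnramifiedAt v ∧ ∀ 𝔓 ∈ v.primesAbove, ∀ σ : Field.absoluteGaloisGroup K, IsArithFrobAt (𝓞 K) σ 𝔓 → ψ.charpoly σ ∣ ρ.charpoly σ) → ∀ (ι : PadicAlgCl ℓ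 ≃+* ℂ), ∃ χ : CuspidalAutomorphicRepData 1 K h1, χ.1.IsRegularAlgebraic ∧ ∀ᶠ v in cofinite, ∃ c : ℂ, χ.1.HasSatakeParamAt v {c} ∧ ψ.IsUnramifiedAt v ∧ ψ.HasFrobCharpolyAt v (arithFrobPolyOfSatake ι v.residueCard 1 {c}))
    (hHE : Clozel1990_heckeEigenvalueField)
    (h22 : JacquetShalika1981_partialPairL_boundary_repData)
    -- the conjecture: Buzzard–Gee 3.1.6 for IRREGULAR, non-Galois-type, non-monomial cuspidal `GL_2`
    (hLA2res : ∀ (K : Type) [Field K] [NumberField K] (hcpt : isCompact_glFiniteIntegralLevel 2 K)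
      (π : CuspidalAutomorphicRepData 2 K hcpt), π.1.IsLAlgebraic →
        (¬ ∃ T : InfinityType K 2, π.1.HasInfinityType T ∧ T.IsRegular) →
        (¬ ∃ σ : FramedArtinRep K 2, σ.toGaloisRep.IsIrreducible ∧ IsPiOfArtinRep σ π.1) →
        (¬ ∃ (E : Type) (_ : Field E) (_ : NumberField E) (_ : Algebra K E) (_ : IsGalois K E)
            (h1 : isCompact_glFiniteIntegralLevel 1 E) (τ : AutomorphicRepData (AutomorphyDatum.gl 1 E h1)),
            τ.IsLAlgebraic ∧ IsAutomorphicInductionAlong τ π.1 ∧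
            ∀ g : E ≃ₐ[K] E, g ≠ 1 →
              ¬ ∀ᶠ w : HeightOneSpectrum (𝓞 E) in cofinite, ∀ α : Multiset ℂ,
                  τ.HasSatakeParamAt w α → τ.HasSatakeParamAt (g • w) α) →
        ∃ E : Subfield ℂ, FiniteDimensional ℚ E ∧
          ∀ᶠ v in cofinite, ∀ α : Multiset ℂ, π.1.HasSatakeParamAt v α →
            ∀ i ≤ 2, α.esymm i ∈ E)
    -- residual open region: rank 3, irregular `π`, not of Galois type, not monomial
    (H3irr' : ∀ (K : Type) [Field K] [NumberField K] (hcpt : isCompact_glFiniteIntegralLevel 3 K)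
      (π : CuspidalAutomorphicRepData 3 K hcpt), π.1.IsLAlgebraic →
        (¬ ∃ T : InfinityType K 3, π.1.HasInfinityType T ∧ T.IsRegular) →
        (¬ ∃ σ : FramedArtinRep K 3, σ.toGaloisRep.IsIrreducible ∧ IsPiOfArtinRep σ π.1) →
        (¬ ∃ (E : Type) (_ : Field E) (_ : NumberField E) (_ : Algebra K E) (_ : IsGalois K E)
            (h1 : isCompact_glFiniteIntegralLevel 1 E) (τ : AutomorphicRepData (AutomorphyDatum.gl 1 E h1)),
            τ.IsLAlgebraic ∧ IsAutomorphicInductionAlong τ π.1 ∧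
            ∀ g : E ≃ₐ[K] E, g ≠ 1 →
              ¬ ∀ᶠ w : HeightOneSpectrum (𝓞 E) in cofinite, ∀ α : Multiset ℂ,
                  τ.HasSatakeParamAt w α → τ.HasSatakeParamAt (g • w) α) →
          ∀ (ℓ : ℕ) [Fact ℓ.Prime] (ι : PadicAlgCl ℓ ≃+* ℂ) (ρ : FramedGaloisRep K (PadicAlgCl ℓ) 3),
            (∀ᶠ v in cofinite, SatakeFrobCompatibleAt ι π.1 ρ v) →
              ρ.toGaloisRep.IsIrreducible)
    -- residual open region: rank 3, `K` neither TR nor CM, `π` regular ess. self-dual, not Galois type, not monomial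
    (H3esd' : ∀ (K : Type) [Field K] [NumberField K], ¬ IsTotallyReal K → ¬ IsCMField K →
      ∀ (h1 : isCompact_glFiniteIntegralLevel 1 K) (hcpt : isCompact_glFiniteIntegralLevel 3 K)
        (π : CuspidalAutomorphicRepData 3 K hcpt), π.1.IsLAlgebraic →
          (∃ T : InfinityType K 3, π.1.HasInfinityType T ∧ T.IsRegular) →
            (∃ η : CuspidalAutomorphicRepData 1 K h1, ∀ᶠ v in cofinite,
              ∀ α : Multiset ℂ, π.1.HasSatakeParamAt v α →
                ∃ c : ℂ, η.1.HasSatakeParamAt v {c} ∧ α.map (fun a => a⁻¹) = α.map (fun a => c * a)) →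
            (¬ ∃ σ : FramedArtinRep K 3, σ.toGaloisRep.IsIrreducible ∧ IsPiOfArtinRep σ π.1) →
            (¬ ∃ (E : Type) (_ : Field E) (_ : NumberField E) (_ : Algebra K E) (_ : IsGalois K E)
                (h1 : isCompact_glFiniteIntegralLevel 1 E)
                (τ : AutomorphicRepData (AutomorphyDatum.gl 1 E h1)),
                τ.IsLAlgebraic ∧ IsAutomorphicInductionAlong τ π.1 ∧
                ∀ g : E ≃ₐ[K] E, g ≠ 1 →
                  ¬ ∀ᶠ w : HeightOneSpectrum (𝓞 E) in cofinite, ∀ α : Multiset ℂ,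
                      τ.HasSatakeParamAt w α → τ.HasSatakeParamAt (g • w) α) →
              ∀ (ℓ : ℕ) [Fact ℓ.Prime] (ι : PadicAlgCl ℓ ≃+* ℂ) (ρ : FramedGaloisRep K (PadicAlgCl ℓ) 3),
                (∀ᶠ v in cofinite, SatakeFrobCompatibleAt ι π.1 ρ v) →
                  ρ.toGaloisRep.IsIrreducible)
    -- open region: rank `≥ 4`, `K` totally real or CM: irreducibility of the attached representation (as v1)
    (H4att : ∀ (n : ℕ), 4 ≤ n → ∀ (K : Type) [Field K] [NumberField K], (IsTotallyReal K ∨ IsCMField K) →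
      ∀ (hcpt : isCompact_glFiniteIntegralLevel n K) (π' : CuspidalAutomorphicRepData n K hcpt),
        π'.1.IsRegularAlgebraic →
          ∀ (ℓ : ℕ) [Fact ℓ.Prime] (ι : PadicAlgCl ℓ ≃+* ℂ) (r : FramedGaloisRep K (PadicAlgCl ℓ) n),
            r.toGaloisRep.IsSemisimple →
              (∀ (v : HeightOneSpectrum (𝓞 K)) (β : Multiset ℂ), π'.1.HasSatakeParamAt v β →
                ((ℓ : ℕ) : 𝓞 K) ∉ v.asIdeal →
                  r.IsUnramifiedAt v ∧ r.HasFrobCharpolyAt v (arithFrobPolyOfSatake ι v.residueCard n β)) →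
              r.toGaloisRep.IsIrreducible)
    -- residual open region: rank `≥ 4`, `π` irregular or `K` neither TR nor CM, not Galois type, not monomial
    (H4rest' : ∀ (n : ℕ), 4 ≤ n → ∀ (K : Type) [Field K] [NumberField K]
      (hcpt : isCompact_glFiniteIntegralLevel n K) (π : CuspidalAutomorphicRepData n K hcpt),
        π.1.IsLAlgebraic →
          ¬ ((IsTotallyReal K ∨ IsCMField K) ∧ ∃ T : InfinityType K n, π.1.HasInfinityType T ∧ T.IsRegular) →
          (¬ ∃ σ : FramedArtinRep K n, σ.toGaloisRep.IsIrreducible ∧ IsPiOfArtinRep σ π.1) →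
          (¬ ∃ (E : Type) (_ : Field E) (_ : NumberField E) (_ : Algebra K E) (_ : IsGalois K E)
              (h1 : isCompact_glFiniteIntegralLevel 1 E)
              (τ : AutomorphicRepData (AutomorphyDatum.gl 1 E h1)),
              τ.IsLAlgebraic ∧ IsAutomorphicInductionAlong τ π.1 ∧
              ∀ g : E ≃ₐ[K] E, g ≠ 1 →
                ¬ ∀ᶠ w : HeightOneSpectrum (𝓞 E) in cofinite, ∀ α : Multiset ℂ,
                    τ.HasSatakeParamAt w α → τ.HasSatakeParamAt (g • w) α) →
            ∀ (ℓ : ℕ) [Fact ℓ.Prime] (ι : PadicAlgCl ℓ ≃+* ℂ) (ρ : FramedGaloisRep K (PadicAlgCl ℓ) n),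
              (∀ᶠ v in cofinite, SatakeFrobCompatibleAt ι π.1 ρ v) → ρ.toGaloisRep.IsIrreducible) :
    ∀ (n : ℕ) (K : Type) [Field K] [NumberField K] (hcpt : isCompact_glFiniteIntegralLevel n K), 0 < n → ∀ (π : CuspidalAutomorphicRepData n K hcpt), π.1.IsLAlgebraic → ¬ (n = 3 ∧ IsCMField K ∧ ∃ T : InfinityType K n, π.1.HasInfinityType T ∧ T.IsRegular) → ∀ (ℓ : ℕ) [Fact ℓ.Prime] (ι : PadicAlgCl ℓ ≃+* ℂ) (ρ : FramedGaloisRep K (PadicAlgCl ℓ) n), (∀ᶠ v : HeightOneSpectrum (𝓞 K) in cofinite, SatakeFrobCompatibleAt ι π.1 ρ v) → ρ.toGaloisRep.IsIrreducible := by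
  intro n K _ _ hcpt hn π hL hsec ℓ _ ι ρ hρ
  rcases le_or_gt 4 n with h4 | h4
  · -- rank `≥ 4`
    haveI : NeZero n := ⟨by omega⟩
    by_cases hc : (IsTotallyReal K ∨ IsCMField K) ∧ ∃ T : InfinityType K n, π.1.HasInfinityType T ∧ T.IsRegular
    · exact isIrreducible_of_isRegular_of_galoisRep_irreducible (fun n K _ _ hcpt => h27 hcpt) hc.1 ι
        (fun π' hRA r hss hr => H4att n h4 K hc.1 hcpt π' hRA ℓ ι r hss hr) π hL hc.2 ρ hρ
    · exact conclusion_of_not_galoisType_not_monomial π ι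
        (fun hG hM => H4rest' n h4 K hcpt π hL hc hG hM ℓ ι) ρ hρ
  interval_cases n
  · -- rank one
    exact isIrreducible_of_rank_one ρ
  · -- rank two: regular → Clozel + JS (p115614); Galois type / monomial → landed regions; else BG 3.1.6
    exact conclusion_rank_two_of_isRegular_or_residual_isLArithmetic hWA hHE h22 π hL
      (hLA2res K hcpt π hL) ι ρ hρ
  · -- rank three
    by_cases hreg : ∃ T : InfinityType K 3, π.1.HasInfinityType T ∧ T.IsRegular
    · by_cases hTR : IsTotallyReal K
      · exact isIrreducible_rank_three_totallyReal_of_isRegular (fun n K _ _ hcpt => h27 hcpt) hBH hTR π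
          hL hreg ι ρ hρ
      by_cases hCM : IsCMField K
      · exact absurd ⟨rfl, hCM, hreg⟩ hsec
      have h1 : isCompact_glFiniteIntegralLevel 1 K := isCompact_glFiniteIntegralLevel_holds 1 K
      by_cases hesd : ∃ η : CuspidalAutomorphicRepData 1 K h1,
          ∀ᶠ v : HeightOneSpectrum (𝓞 K) in cofinite, ∀ α : Multiset ℂ, π.1.HasSatakeParamAt v α →
            ∃ c : ℂ, η.1.HasSatakeParamAt v {c} ∧ α.map (fun a => a⁻¹) = α.map (fun a => c * a)
      · exact conclusion_of_not_galoisType_not_monomial π ι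
          (fun hG hM => H3esd' K hTR hCM h1 hcpt π hL hreg hesd hG hM ℓ ι) ρ hρ
      · exact isIrreducible_rank_three_of_isRegular_of_not_essSelfDual hWA hHE h22 h1 π hL hreg
          (fun η hη => hesd ⟨η, hη⟩) ι ρ hρ
    · exact conclusion_of_not_galoisType_not_monomial π ι
        (fun hG hM => H3irr' K hcpt π hL hreg hG hM ℓ ι) ρ hρ

end Summit.Langlands.Langlands.Theorems.IrreducibleOffSector

end
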